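import Literature.MathematicalPhysics.QuantumFieldTheory.Balaban1983to89.B7Prop10GeneralRec
import Literature.MathematicalPhysics.QuantumFieldTheory.Balaban1983to89.B7Eq214General
import Literature.MathematicalPhysics.QuantumFieldTheory.Balaban1983to89.B7ConclGaugeLin

/-!
# `Balaban1983to89.B7Eq211GeneralRec` — [Balaban1985Averaging] (209)–(211) p. 50: the ONE-STEP linearisation `log ṽ′(y) = Σ_{x∈B(y)} L^{−d}(R_{0,y}λ)(x) + O(α₄Lα′₄ + L²α′₃α′₄)` AT A GENERAL REGULAR
# BACKGROUND, FOR THE RECORD (centred blocks, (0.4) average) — the record twin of the engine's `B7Eq214Flat.eq211_flat` + `B7Eq214General` §1–§2 (sequel: `B7Eq214GeneralRec`)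

statement-level skeleton of published theorems with citation tags; proofs where landed; nothing here is a claim about the Yang–Mills mass gap

CITATION HEADER (lean-in-tree rule).  Cell `pub-ymgap`, seat `pub-ymgap-dag-n05-e` g36 (N05-REC LEAD PEN); item R1 ([3] layer), Sect. G block, file 7: the record twin of `B7Eq214General` §1–§2 (+ the
flat one-step `eq211_flat`).  `--kind proof --supports stmt-QuantumFields-20541` (K0⁷; count-neutral; no definition).  Sources READ: [3] = [Balaban1985Averaging] p. 50 (207)–(214), p. 46 (180)–(184),
p. 47 (187), p. 30 (78) (`paper:balaban1985-cmp98-averaging`); [I] = [Balaban1987RG1] (0.3)–(0.4) pp. 252–253.  REUSED BY NAME: the engine's `B7Eq214Flat.{eq210, bmean_sub, norm_cj_sub_self_le}`,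
`B7Eq214General.Cgen`, `B7Eq214.{ineq176_of_207, ineq177_of_207}`, `B7.sum_pow_succ_le`, `B7Prop9General.{rotClamp, rotClamp_mul, siteBd_rotClamp, bondBd_rotClamp, CovBondBd}`, `B7Prop10General.{C6, C4G,
rhs203G_le, rhs204G_le, covBondBd_mono}`; this seat's `B7Prop9FlatRec.{block_walkZ, eq184Z, SexpZ_eq_bmean}`, `B7Prop9GeneralRec.{clamp_of_mem, off_mem_boxZ, boxZ_le, l1_le_of_mem_boxZ, rotClamp_axial_blockZ,
R0avgZ_eq_savgZ_rotClamp}`, `B7Prop10GeneralRec.{prop10_generalZ, levels_of52Z}`; the record's `B7SectEFLinearisationRec.{rlamZ, lamAvgGZ, utilGZ, vtilGZ, InLambdaZ, CovBlockBdZ}`.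

WHAT IS PROVED (sorry-free; `L = 2s + 1`, `s ≥ 1`, `d ≥ 1`).  §0 record helpers (`exists_offZ_of_clamp`, `blockBdZ_rotClamp`, `rlamZ_sub`); §1 ★`eq211_flatZ` ((209)∕(211) at `V₀ = 1` on centred blocks:
`‖log ṽ′(z) − Σ_r L^{−d} log v′(Lz + offZ r)‖ ≤ 448(d+1)Lα₄α′₄ + 368(d+1)Lα′₄q`); §2 `norm_rlamZ_le`, ★★`eq211Z_general` ((209)–(211) at a general background for the record); the levels (212)–(214) are the sequel `B7Eq214GeneralRec`.
HONEST SCOPE.  Port of the engine's estimates to the record's objects (same constants); nothing of [3]∕[I] asserted beyond what is proved; `HThm4Rec` UNDISCHARGED; N05 discharged of record untouched;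
N07 not claimable; counts unmoved (typed 28∕28 · discharged 8∕28); one finite 𝕋⁴ programme at fixed ε — nothing continuum ∕ ℝ⁴ ∕ OS ∕ mass gap ∕ Clay.  No `def`, no `instance`, no `notation`, no `sorry`.
-/

set_option autoImplicit false

noncomputable section

open scoped BigOperators
open NormedSpace Finset

namespace Literature.MathematicalPhysics.QuantumFieldTheory.Balaban1983to89.B7Eq211GeneralRec

open B7Prop1Explicit hiding Site
open B7Prop1Explicit renaming Site → SiteZ
open MatrixLog B7Eq92Concrete
open B7Eq99Concrete (R0fun R0fun_apply R0fun_self R0fun_add)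
open B7Prop2Explicit (pdev c2')
open B7Eq170Flat (cj cj_apply val_Rc_eq_cj mlog_cj bmean bmean_apply bmean_const norm_bmean_le bchRem norm_bchRem_le exp_mul_exp_eq mlog_exp_of_le)
open B7Prop6Flat (norm_units_inv_sub_one_le)
open B7Prop8Flat (pow_eta_le)
open B7Prop9Flat (SiteBd BondBd Vb Ab setup C5')
open B7Prop9General (clamp clampZ rotClamp rotClamp_mul siteBd_rotClamp bondBd_rotClamp CovBondBd)
open B7Prop10Flat (siteBd_mono one_le_C5)
open B7Prop10General (C6 C4G rhs203G rhs204G rhs203G_le rhs204G_le covBondBd_mono)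
open B7Eq214Flat (eq210 bmean_sub)
open B7Eq214General (Cgen)
open BlockAveragingZd (avgIterZ offZ natAbs_offZ_le)
open B8Lemma1NonAbelianRecLoops (halfVec)
open B7SectCDGaugeAveragesRec (SexpZ savgZ R0avgZ uavgZ)
open B7SectEFLinearisationRec (rlamZ lamAvgGZ lamAvgGZ_zero lamAvgGZ_succ utilGZ utilGZ_zero utilGZ_succ vtilGZ InLambdaZ Cond167Z CovBlockBdZ)
open B7Prop2Rec (AvgClosedZ C0Z)
open B7Prop9FlatRec (savgZ_apply SexpZ_eq_bmean block_walkZ eq184Z)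
open B7Prop9GeneralRec (clamp_of_mem off_mem_boxZ boxZ_le l1_le_of_mem_boxZ rotClamp_axial_blockZ R0avgZ_eq_savgZ_rotClamp)
open B7Prop10GeneralRec (prop10_generalZ levels_of52Z)
open B7ConclGaugeLin (two_le_C6')

variable {d : ℕ}

/-! ## §0 Record helpers: clamped points are centred block points; (180d) transfers to the rotated data on all centred blocks; `rlamZ` bookkeeping -/

section Helpers

variable {𝔸 : Type*} [NormedRing 𝔸] [NormOneClass 𝔸] [NormedAlgebra ℂ 𝔸] [CompleteSpace 𝔸]
variable {L s : ℕ}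

omit [NormOneClass 𝔸] [NormedAlgebra ℂ 𝔸] [CompleteSpace 𝔸] in
/-- Every point clamped into the centred block `[q − s𝟙, q + s𝟙]` is a block point `q + offZ L r` (`L = 2s + 1`). [cite: Balaban1987RG1, (0.3) p.252 (bookkeeping)] -/
theorem exists_offZ_of_clamp (hLs : L = 2 * s + 1) (q x : SiteZ d) :
    ∃ r : Fin d → Fin L, clamp (q - (halfVec L : SiteZ d)) (q + (halfVec L : SiteZ d)) x = q + offZ L r := by
  have hs2 : (L - 1) / 2 = s := by omega
  have hmem : ∀ i : Fin d, q i - s ≤ clamp (q - (halfVec L : SiteZ d)) (q + (halfVec L : SiteZ d)) x i ∧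
      clamp (q - (halfVec L : SiteZ d)) (q + (halfVec L : SiteZ d)) x i ≤ q i + s := by
    intro i
    simp only [clamp, clampZ, Pi.sub_apply, Pi.add_apply, halfVec, hs2, max_def, min_def]
    split_ifs <;> constructor <;> omega
  refine ⟨fun i => ⟨(clamp (q - (halfVec L : SiteZ d)) (q + (halfVec L : SiteZ d)) x i - q i + s).toNat, ?_⟩, ?_⟩
  · have := hmem i; omega
  · funext i
    have := hmem i
    simp only [Pi.add_apply, BlockAveragingZd.offZ_apply, hs2]
    omega

omit [NormOneClass 𝔸] [NormedAlgebra ℂ 𝔸] [CompleteSpace 𝔸] in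
/-- **(180d)/(167) transfers to the rotated data, on ALL centred blocks** (record twin of the engine's `blockBd_rotClamp`): if the block quantities `v(q)⁻¹(R_{0,q}v)(q + n)` of the centred block
are within `β ≤ ½` of `1`, the clamped rotated function `W` in the axial gauge at `q` satisfies `‖W(Lz)⁻¹W(Lz + n) − 1‖ ≤ 4β` for every block of `ℤᵈ`. [cite: Balaban1985Averaging, (180) p.46, (167) p.44, p.27 (display after (59))] -/
theorem blockBdZ_rotClamp (hLs : L = 2 * s + 1) (V₀ : SiteZ d → Fin d → 𝔸ˣ) {v : SiteZ d → 𝔸ˣ} {β : ℝ} (q : SiteZ d)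
    (hq : ∀ r : Fin d → Fin L, ‖((((v q)⁻¹ * R0fun V₀ q v (q + offZ L r) : 𝔸ˣ)) : 𝔸) - 1‖ ≤ β) (hβ : β ≤ 1 / 2) :
    ∀ (z : SiteZ d) (r : Fin d → Fin L),
      ‖((((rotClamp (axialFn V₀ q) (q - (halfVec L : SiteZ d)) (q + (halfVec L : SiteZ d)) v ((L : ℤ) • z))⁻¹ *
        rotClamp (axialFn V₀ q) (q - (halfVec L : SiteZ d)) (q + (halfVec L : SiteZ d)) v ((L : ℤ) • z + offZ L r) : 𝔸ˣ)) : 𝔸) - 1‖ ≤ 4 * β := by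
  have hβ0 : 0 ≤ β := (norm_nonneg _).trans (hq fun _ => ⟨0, by omega⟩)
  set W : SiteZ d → 𝔸ˣ := rotClamp (axialFn V₀ q) (q - (halfVec L : SiteZ d)) (q + (halfVec L : SiteZ d)) v with hW
  have hquot : ∀ x : SiteZ d, ‖((((W q)⁻¹ * W x : 𝔸ˣ)) : 𝔸) - 1‖ ≤ β := by
    intro x
    obtain ⟨r, hr⟩ := exists_offZ_of_clamp (d := d) hLs q x
    have hWx : W x = W (q + offZ L r) := by
      rw [hW]
      simp only [rotClamp, hr, clamp_of_mem (off_mem_boxZ hLs q r)]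
    rw [hWx, hW, rotClamp_axial_blockZ hLs]
    exact hq r
  intro z r
  set X : 𝔸ˣ := (W q)⁻¹ * W ((L : ℤ) • z) with hX
  set Y : 𝔸ˣ := (W q)⁻¹ * W ((L : ℤ) • z + offZ L r) with hY
  have hid : (W ((L : ℤ) • z))⁻¹ * W ((L : ℤ) • z + offZ L r) = X⁻¹ * Y := by rw [hX, hY]; group
  have hX1 : ‖(X : 𝔸) - 1‖ ≤ β := hquot _
  have hY1 : ‖(Y : 𝔸) - 1‖ ≤ β := hquot _
  have hXi : ‖((X⁻¹ : 𝔸ˣ) : 𝔸) - 1‖ ≤ 2 * β := (norm_units_inv_sub_one_le X (hX1.trans hβ)).trans (by linarith)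
  show ‖((((W ((L : ℤ) • z))⁻¹ * W ((L : ℤ) • z + offZ L r) : 𝔸ˣ)) : 𝔸) - 1‖ ≤ 4 * β
  rw [hid, Units.val_mul]
  have h1 := B7Prop6Bound.mul_sub_one_norm_le (((X⁻¹ : 𝔸ˣ)) : 𝔸) (Y : 𝔸)
  have hA0 := norm_nonneg ((((X⁻¹ : 𝔸ˣ)) : 𝔸) - 1)
  have hB0 := norm_nonneg ((Y : 𝔸) - 1)
  nlinarith

omit [NormOneClass 𝔸] [CompleteSpace 𝔸] in
/-- `rlamZ` is additive in `f`: `Q′(f − g) = Q′f − Q′g`. [cite: Balaban1985Averaging, (211)–(212) p.50] -/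
theorem rlamZ_sub (L : ℕ) (V₀ : SiteZ d → Fin d → 𝔸ˣ) (f g : SiteZ d → 𝔸) (y : SiteZ d) :
    rlamZ L V₀ f y - rlamZ L V₀ g y = rlamZ L V₀ (fun x => f x - g x) y := by
  simp only [rlamZ, bmean_apply, cj_apply, mul_sub, sub_mul, smul_sub, Finset.sum_sub_distrib]

end Helpers

/-! ## §1 (209)/(211): the one-step linearisation at `V₀ = 1`, record blocks -/

section FlatStep

variable {𝔸 : Type*} [NormedRing 𝔸] [NormedAlgebra ℂ 𝔸] [CompleteSpace 𝔸]

/-- **(209)/(211) at the flat background, kernel form with explicit constants.**  Print (211): "`(1/i) log ṽ′(y) =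
Σ_{x∈B(y)} L^{−d}(R_{0,y}λ)(x) + O(α₄Lα′₄ + L²α′₃α′₄ + L²α′₄²)`" (`λ = (1/i) log v′`, `ṽ′` the one-step average (179)/(184)).
Here, at `V₀ = 1` (`R_{0,y} = id`): for `v′, v₁ : ℤ^d → 𝔸ˣ` with `‖v′ − 1‖ ≤ α₄` (176), `‖v′(b₋)⁻¹v′(b₊) − 1‖ ≤ α′₄` (177),
`‖v₁ − 1‖ ≤ α₃` (166), `‖v₁(Lz)⁻¹v₁(Lz + r) − 1‖ ≤ q` on the blocks (167; `q = Lα′₃`), and the explicit smallness `0 ≤ α₄ ≤ 1/50`,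
`0 ≤ α′₄`, `10³(d+1)Lα′₄ ≤ 1`, `α₃ ≤ 1/5`, `q ≤ 1/50`:
`‖log ṽ′(z) − Σ_{r∈[0,L)^d} L^{−d} log v′(Lz + r)‖ ≤ 448(d+1)·L·α₄α′₄ + 368(d+1)·L·α′₄q`
(`ṽ′ = B7Prop9Flat.vtil L v′ v₁`; the block mean `B7Eq170Flat.bmean`).  Proof = print's: (184) `ṽ′(y) = v′(y)e^{S_{v′}(y) + Φ}`,
`‖Φ‖ ≤ 92·2θ·q` (`B7Prop9Flat.eq184` with `θ = (d+1)L(α′₄ + 4α′₄²)` from (187) `block_walk`); each summand of `S_{v′}(y)` is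
`log(e^{−λ(y)}e^{λ(x)}) = λ(x) − λ(y) + O(12·8θ·2α₄)` by (210) (`eq210`); the final merge `log(e^{λ(y)}e^{S+Φ})` by (31)
(`B7Eq170Flat.exp_mul_exp_eq`, `mlog_exp_of_le`). [cite: Balaban1985Averaging, (209)–(211) p.50] -/
theorem eq211_flatZ {L : ℕ} (hL : 1 ≤ L) {v' v₁ : SiteZ d → 𝔸ˣ} {α₄ α₄' α₃ q : ℝ}
    (h4a : SiteBd v' α₄) (h4b : BondBd v' α₄') (h3c : SiteBd v₁ α₃) (hq : ∀ (z : SiteZ d) (r : Fin d → Fin L), ‖((((v₁ ((L : ℤ) • z))⁻¹ * v₁ ((L : ℤ) • z + offZ L r) : 𝔸ˣ)) : 𝔸) - 1‖ ≤ q)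
    (hα₄0 : 0 ≤ α₄) (hα₄ : α₄ ≤ 1 / 50) (hα₄' : 0 ≤ α₄') (hs : 1000 * ((d : ℝ) + 1) * L * α₄' ≤ 1)
    (hα₃ : α₃ ≤ 1 / 5) (hq1 : q ≤ 1 / 50) (z : SiteZ d) :
    ‖mlog (((savgZ L (v' * v₁) ((L : ℤ) • z) * (savgZ L v₁ ((L : ℤ) • z))⁻¹) : 𝔸ˣ) : 𝔸) -
        bmean L (fun r => mlog ((v' ((L : ℤ) • z + offZ L r) : 𝔸ˣ) : 𝔸))‖
      ≤ 448 * ((d : ℝ) + 1) * L * α₄ * α₄' + 368 * ((d : ℝ) + 1) * L * α₄' * q := by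
  obtain ⟨hVA, h4, ha0, ha2, hθ0, hθ1, hθ2⟩ := setup hL h4b hα₄' hs
  set θ : ℝ := ((d : ℝ) + 1) * L * (α₄' + 4 * α₄' ^ 2) with hθ
  set y : SiteZ d := (L : ℤ) • z with hy
  have hq0 : 0 ≤ q := (norm_nonneg _).trans (hq z fun _ => ⟨0, hL⟩)
  -- (187) on the block and (184)
  have hb := block_walkZ ha0 hVA hθ0 (hθ1.trans (by norm_num)) le_rfl y
  have hw' : ‖((v₁ y : 𝔸ˣ) : 𝔸) - 1‖ ≤ 2 / 5 := (h3c y).trans (by linarith)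
  have hw : ‖((((v₁ y)⁻¹ : 𝔸ˣ)) : 𝔸) - 1‖ ≤ 2 / 5 :=
    (norm_units_inv_sub_one_le (v₁ y) ((h3c y).trans (by linarith))).trans (by linarith [h3c y])
  obtain ⟨Φ, hΦ, hΦn⟩ := eq184Z (L := L) (v' := v') (v₁ := v₁) (y := y) (p := 2 * θ) (q := q)
    (fun r => (hb r).1) (fun r => hq z r) hw hw' hL (by linarith) hq1
  -- the logarithm `λ = log v′` and the centre value `Y = λ(y)`
  set lam : SiteZ d → 𝔸 := fun x => mlog ((v' x : 𝔸ˣ) : 𝔸) with hlam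
  have hv : ∀ x, v' x = expUnit (lam x) := fun x =>
    Units.ext (by rw [val_expUnit, hlam]; exact (exp_mlog (lt_of_le_of_lt (h4a x) (by linarith))).symm)
  have hlamn : ∀ x, ‖lam x‖ ≤ 2 * α₄ := fun x =>
    (norm_mlog_le_two_mul ((h4a x).trans (by linarith))).trans (by linarith [h4a x])
  set Y : 𝔸 := lam y with hYdef
  have hY : ‖Y‖ ≤ 2 * α₄ := hlamn y
  have hY25 : ‖Y‖ ≤ 1 / 25 := hY.trans (by linarith)
  -- per block point: `M_r := log v′(y)⁻¹v′(x) = λ(x) − λ(y) + err_r`, `‖err_r‖ ≤ 192θα₄`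
  set M : (Fin d → Fin L) → 𝔸 := fun r => mlog ((((v' y)⁻¹ * v' (y + offZ L r) : 𝔸ˣ)) : 𝔸) with hMdef
  set X : (Fin d → Fin L) → 𝔸 := fun r => lam (y + offZ L r) - Y with hXdef
  have hMX : ∀ r, ‖M r - X r‖ ≤ 192 * θ * α₄ := by
    intro r
    have hXa : ‖X r‖ ≤ 1 / 10 := by
      calc ‖X r‖ ≤ ‖lam (y + offZ L r)‖ + ‖Y‖ := norm_sub_le _ _
        _ ≤ 2 * α₄ + 2 * α₄ := add_le_add (hlamn _) hY
        _ ≤ 1 / 10 := by linarith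
    have hval : ((((v' y)⁻¹ * v' (y + offZ L r) : 𝔸ˣ)) : 𝔸) = exp (-Y) * exp (X r + Y) := by
      rw [hv y, hv (y + offZ L r), Units.val_mul, val_inv_expUnit, val_expUnit, val_expUnit, hXdef]
      simp only [sub_add_cancel, hYdef]
    have h210 : ‖M r - X r‖ ≤ 12 * ‖X r‖ * ‖Y‖ := by
      rw [hMdef]; simp only; rw [hval]; exact eq210 hXa hY25
    have hMn : ‖M r‖ ≤ 4 * θ := (hb r).2.1
    -- a priori: ‖X‖ ≤ ‖M‖ + 12‖X‖‖Y‖ ≤ 4θ + 24α₄‖X‖, so ‖X‖ ≤ 8θ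
    have hXn : ‖X r‖ ≤ 8 * θ := by
      have h1 : ‖X r‖ ≤ ‖M r‖ + ‖M r - X r‖ := by
        have := norm_sub_le (M r) (M r - X r); simp only [sub_sub_cancel] at this; exact this
      have h2 : 12 * ‖X r‖ * ‖Y‖ ≤ 12 * ‖X r‖ * (2 * α₄) :=
        mul_le_mul_of_nonneg_left hY (by positivity)
      nlinarith [norm_nonneg (X r)]
    calc ‖M r - X r‖ ≤ 12 * ‖X r‖ * ‖Y‖ := h210
      _ ≤ 12 * (8 * θ) * (2 * α₄) := by gcongr
      _ = 192 * θ * α₄ := by ring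
  -- the exponent `S = S_{v′}(y) = bmean λ − Y + bmean err`
  set S : 𝔸 := SexpZ L v' y with hSdef
  have hlamfun : (fun r : Fin d → Fin L => mlog ((v' (y + offZ L r) : 𝔸ˣ) : 𝔸)) =
      fun r => lam (y + offZ L r) := rfl
  have hS : S = bmean L (fun r => lam (y + offZ L r)) - Y + bmean L (fun r => M r - X r) := by
    rw [hSdef, SexpZ_eq_bmean]
    have h1 : bmean L (fun r => M r - X r) = bmean L M - bmean L X := bmean_sub L M X
    have h2 : bmean L X = bmean L (fun r => lam (y + offZ L r)) - Y := by
      rw [hXdef, bmean_sub, bmean_const hL]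
    rw [h1, h2, ← hMdef]
    abel
  have hSn : ‖S‖ ≤ 4 * θ := by
    rw [hSdef, SexpZ_eq_bmean]; exact norm_bmean_le hL fun r => (hb r).2.1
  have hE : ‖bmean L (fun r => M r - X r)‖ ≤ 192 * θ * α₄ := norm_bmean_le hL hMX
  -- (184) ⇒ ṽ′(z) = e^{Y}·e^{S+Φ} = e^{T}
  have hΦ4 : ‖Φ‖ ≤ 4 * θ := hΦn.trans (by nlinarith)
  have hSΦ : ‖S + Φ‖ ≤ 8 * θ := (norm_add_le _ _).trans (by linarith)
  have hsum5 : ‖Y‖ + ‖S + Φ‖ ≤ 1 / 5 := by linarith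
  set b : 𝔸 := bchRem Y (S + Φ) with hbdef
  have hval : (((savgZ L (v' * v₁) ((L : ℤ) • z) * (savgZ L v₁ ((L : ℤ) • z))⁻¹) : 𝔸ˣ) : 𝔸) = exp (Y + (S + Φ) + b) := by
    rw [← hy, hΦ, Units.val_mul, val_expUnit, hv y, val_expUnit, ← hYdef, hbdef]
    exact exp_mul_exp_eq hsum5
  have hbch : ‖b‖ ≤ 32 * θ * α₄ := by
    refine (norm_bchRem_le hsum5).trans ?_
    calc 2 * ‖Y‖ * ‖S + Φ‖ ≤ 2 * (2 * α₄) * (8 * θ) := by gcongr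
      _ = 32 * θ * α₄ := by ring
  have hT5 : ‖Y + (S + Φ) + b‖ ≤ 1 / 5 := by
    refine (norm_add_le _ _).trans ?_
    have := norm_add_le Y (S + Φ)
    nlinarith
  have hgoal : mlog (((savgZ L (v' * v₁) ((L : ℤ) • z) * (savgZ L v₁ ((L : ℤ) • z))⁻¹) : 𝔸ˣ) : 𝔸) - bmean L (fun r => mlog ((v' (y + offZ L r) : 𝔸ˣ) : 𝔸)) =
      bmean L (fun r => M r - X r) + Φ + b := by
    rw [hval, mlog_exp_of_le hT5, hlamfun, hS]
    abel
  rw [hy] at hgoal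
  rw [hgoal]
  calc _ ≤ ‖bmean L (fun r => M r - X r)‖ + ‖Φ‖ + ‖b‖ := norm_add₃_le
    _ ≤ 192 * θ * α₄ + 92 * (2 * θ) * q + 32 * θ * α₄ := by linarith
    _ = 224 * θ * α₄ + 184 * θ * q := by ring
    _ ≤ 224 * (2 * (((d : ℝ) + 1) * L * α₄')) * α₄ + 184 * (2 * (((d : ℝ) + 1) * L * α₄')) * q := by
        gcongr
    _ = 448 * ((d : ℝ) + 1) * L * α₄ * α₄' + 368 * ((d : ℝ) + 1) * L * α₄' * q := by ring

end FlatStep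

/-! ## §2 (209)–(211) at a general background, record blocks -/

section OneStep

variable {𝔸 : Type*} [NormedRing 𝔸] [NormOneClass 𝔸] [NormedAlgebra ℂ 𝔸] [CompleteSpace 𝔸]
variable {L s : ℕ}

omit [CompleteSpace 𝔸] in
/-- `norm_rlam_le`: the rotated block mean does not increase the sup norm (rotations by `U1`-valued transporters are
contractions, the weights `L^{−d}` sum to one). [cite: Balaban1985Averaging, (211)–(212) p.50, (78) p.30] -/
theorem norm_rlamZ_le {L : ℕ} (hL : 1 ≤ L) {V₀ : SiteZ d → Fin d → 𝔸ˣ} (hV : ∀ x κ, V₀ x κ ∈ U1 𝔸) {f : SiteZ d → 𝔸}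
    {M : ℝ} (hf : ∀ x, ‖f x‖ ≤ M) (y : SiteZ d) : ‖rlamZ L V₀ f y‖ ≤ M :=
  norm_bmean_le hL fun r => by
    obtain ⟨h1, h2⟩ := mem_U1.mp (hol_mem hV y (treeWord (offZ L r)))
    refine le_trans ?_ (hf (y + offZ L r))
    rw [cj_apply]
    calc _ ≤ ‖((hol V₀ y (treeWord (offZ L r)) : 𝔸ˣ) : 𝔸)‖ * ‖f (y + offZ L r)‖ * ‖(((hol V₀ y (treeWord (offZ L r)))⁻¹ : 𝔸ˣ) : 𝔸)‖ :=
          (norm_mul_le _ _).trans (mul_le_mul_of_nonneg_right (norm_mul_le _ _) (norm_nonneg _))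
      _ ≤ 1 * ‖f (y + offZ L r)‖ * 1 := mul_le_mul (mul_le_mul_of_nonneg_right h1 (norm_nonneg _)) h2 (norm_nonneg _) (by positivity)
      _ = ‖f (y + offZ L r)‖ := by ring

/-- **(209)–(211) AT A GENERAL BACKGROUND `V₀`, kernel form with explicit constants.**  Print (p. 50): "From (184), (187), we have
for `v′ = e^{iλ}` `ṽ′(y) = exp[iλ(y) + iΣ_{x∈B(y)}L^{−d}(R_{0,y}A)(Γ_{y,x}) + O(α₄Lα′₄) + O(L²(α′₃ + α′₄)α′₄)]`. (209) … hence
`(1/i) log ṽ′(y) = Σ_{x∈B(y)} L^{−d}(R_{0,y}λ)(x) + O(α₄Lα′₄ + L²α′₃α′₄ + L²α′₄²)`. (211)" — `ṽ′ = \overline{R₀v′v₁}(\overline{R₀v₁})⁻¹`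
the one step (179) at `V₀` (`B7Prop9General.vtilG`), `λ = (1/i) log v′`, under (180) p. 46.
HERE: `V₀` with values in `U1` (print: `G ⊂ U(N)`), `‖V₀(∂p) − 1‖ ≤ α₀` on all unit plaquettes, `v′, v₁` with (180a)
`‖v′ − 1‖ ≤ α₄ ≤ 1/50`, (180b) `CovBondBd V₀ v′ α′₄`, (180c) `‖v₁ − 1‖ ≤ α₃ ≤ 1/5`, (180d) `CovBlockBdZ L V₀ v₁ β` with `200β ≤ 1` (print:
`β = Lα′₃`), and the smallness `10³(d+1)L·a′ ≤ 1`, `a′ := α′₄ + 4dL·α₀α₄`; then at every block corner `y = Lz`, with `λ = log v′`: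
`‖log ṽ′(y) − Σ_{x∈B(y)} L^{−d}(R_{0,y}λ)(x)‖ ≤ 448(d+1)L·α₄a′ + 368(d+1)L·a′·(4β)`.
PROOF = REDUCTION TO `B7Eq214Flat.eq211_flat`: in the axial gauge `w = V₀(Γ_{y,·})` (`B7Prop1Explicit.axialFn`) the twisted averages
(78) are the flat averages of the rotated data clamped to the block (`B7Prop9General.R0avg_eq_savg_rotClamp`, `rotClamp_mul`), so
`ṽ′(y)` is the flat `B7Prop9Flat.vtil` of `R(w)v′`, `R(w)v₁`; the flat (180) transfer (`siteBd_rotClamp`; `bondBd_rotClamp` with the thin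
axial loops `≤ dLα₀`, `B7Prop1Explicit.axial_bond_bound`; `blockBd_rotClamp`); and `log R(w(x))v′(x) = R(w(x)) log v′(x) =
(R_{0,y}λ)(x)` (`B7Eq170Flat.mlog_cj`, (57)) identifies the flat main term with print's.  READING: print's (211) carries no `α₀`-term
(its derivation only meets covariant bond variables along `Γ_{y,x}`); the `4dL·α₀α₄` inside `a′` is the price of the flat kernel's
global bond hypothesis (cf. `B7Prop9General` READING (b)); no `L²α′₄²`-term is needed ((210) bilinear, `B7Eq214Flat.eq210`).
[cite: Balaban1985Averaging, (209)–(211) p.50, (180)–(184) p.46, (187) p.47, (78) p.30, (57) p.27] -/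
theorem eq211Z_general (hLs : L = 2 * s + 1) {V₀ : SiteZ d → Fin d → 𝔸ˣ} (hV : ∀ x κ, V₀ x κ ∈ U1 𝔸)
    {α₀ : ℝ} (hα₀ : 0 ≤ α₀)
    (h44 : ∀ (x : SiteZ d) (κ μ : Fin d), κ ≠ μ → ‖((hol V₀ x (plaqWord κ μ) : 𝔸ˣ) : 𝔸) - 1‖ ≤ α₀)
    {v' v₁ : SiteZ d → 𝔸ˣ} {α₃ α₄ α₄' β : ℝ}
    (h4a : SiteBd v' α₄) (h4b : CovBondBd V₀ v' α₄') (h3c : SiteBd v₁ α₃) (h3d : CovBlockBdZ L V₀ v₁ β)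
    (hα₄ : α₄ ≤ 1 / 50) (hα₄' : 0 ≤ α₄') (hα₃ : α₃ ≤ 1 / 5) (hβ : 200 * β ≤ 1)
    (hs : 1000 * ((d : ℝ) + 1) * L * (α₄' + 4 * (d * L * α₀) * α₄) ≤ 1) (z : SiteZ d) :
    ‖mlog ((vtilGZ L V₀ v' v₁ ((L : ℤ) • z) : 𝔸ˣ) : 𝔸) - rlamZ L V₀ (fun x => mlog ((v' x : 𝔸ˣ) : 𝔸)) ((L : ℤ) • z)‖
      ≤ 448 * ((d : ℝ) + 1) * L * α₄ * (α₄' + 4 * (d * L * α₀) * α₄) +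
        368 * ((d : ℝ) + 1) * L * (α₄' + 4 * (d * L * α₀) * α₄) * (4 * β) := by
  have hL : 1 ≤ L := by omega
  set q : SiteZ d := (L : ℤ) • z with hq
  set w : SiteZ d → 𝔸ˣ := axialFn V₀ q with hwdef
  set W' : SiteZ d → 𝔸ˣ := rotClamp w (q - (halfVec L : SiteZ d)) (q + (halfVec L : SiteZ d)) v' with hW'
  set W₁ : SiteZ d → 𝔸ˣ := rotClamp w (q - (halfVec L : SiteZ d)) (q + (halfVec L : SiteZ d)) v₁ with hW₁
  set a' : ℝ := α₄' + 4 * (d * L * α₀) * α₄ with ha'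
  have hα₄0 : 0 ≤ α₄ := (norm_nonneg _).trans (h4a 0)
  have hw : ∀ x, w x ∈ U1 𝔸 := fun x => axialFn_mem hV q x
  have hbox := boxZ_le (d := d) L q
  -- the flat hypotheses (180) for the rotated data
  have hG : ∀ (p : SiteZ d) (κ : Fin d), (∀ i : Fin d, (q - (halfVec L : SiteZ d)) i ≤ p i ∧ p i ≤ (q + (halfVec L : SiteZ d)) i) →
      (∀ i : Fin d, (q - (halfVec L : SiteZ d)) i ≤ (p + e κ) i ∧ (p + e κ) i ≤ (q + (halfVec L : SiteZ d)) i) →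
      ‖((gaugeAct w V₀ p κ : 𝔸ˣ) : 𝔸) - 1‖ ≤ d * L * α₀ := by
    intro p κ hp _
    refine (axial_bond_bound V₀ hV q h44 hα₀ p κ).trans ?_
    exact mul_le_mul_of_nonneg_right (l1_le_of_mem_boxZ hLs hp) hα₀
  have hg0 : 0 ≤ (d : ℝ) * L * α₀ := by positivity
  have h4bW : BondBd W' a' := bondBd_rotClamp hbox hw hV hg0 hG h4a (hα₄.trans (by norm_num)) h4b hα₄'
  have h4aW : SiteBd W' α₄ := siteBd_rotClamp hw _ _ h4a
  have h3cW : SiteBd W₁ α₃ := siteBd_rotClamp hw _ _ h3c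
  have hβq : ∀ r : Fin d → Fin L, ‖((((v₁ q)⁻¹ * R0fun V₀ q v₁ (q + offZ L r) : 𝔸ˣ)) : 𝔸) - 1‖ ≤ β :=
    fun r => h3d z r
  have h3dW := blockBdZ_rotClamp hLs V₀ q hβq (by linarith)
  have ha'0 : 0 ≤ a' := by positivity
  -- `ṽ′(y)` is the flat one-step object of the rotated data
  have hid : vtilGZ L V₀ v' v₁ q = savgZ L (W' * W₁) q * (savgZ L W₁ q)⁻¹ := by
    rw [vtilGZ, R0avgZ_eq_savgZ_rotClamp hLs, R0avgZ_eq_savgZ_rotClamp hLs, rotClamp_mul]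
  -- the main term: `log R(w(x))v′(x) = R(V₀(Γ_{y,x})) log v′(x)`
  have hval : ∀ r : Fin d → Fin L, W' (q + offZ L r) = Rc (hol V₀ q (treeWord (offZ L r))) (v' (q + offZ L r)) := by
    intro r
    rw [hW']
    simp only [rotClamp, clamp_of_mem (off_mem_boxZ hLs q r), hwdef]
    simp [axialFn]
  have hmain : bmean L (fun r => mlog ((W' (q + offZ L r) : 𝔸ˣ) : 𝔸)) =
      rlamZ L V₀ (fun x => mlog ((v' x : 𝔸ˣ) : 𝔸)) q := by
    simp only [rlamZ, hval, val_Rc_eq_cj, mlog_cj]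
  have key := eq211_flatZ hL h4aW h4bW h3cW h3dW hα₄0 hα₄ ha'0 hs hα₃ (by linarith) z
  rw [hid, ← hmain]
  exact key

end OneStep


end Literature.MathematicalPhysics.QuantumFieldTheory.Balaban1983to89.B7Eq211GeneralRec
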